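import Summits.BirchSwinnertonDyer.BirchSwinnertonDyer.Theorems.GenusKolyvaginAtTwoPowDvdShaCardAtTwoRTPrimeSwapping
import Summits.BirchSwinnertonDyer.BirchSwinnertonDyer.Theorems.GenusKolyvaginAtTwoPowDvdShaCardAtTwoRTPrimeSwappingRank
import HarnessLib

/-!
# Route `GenusKolyvaginAtTwo`, crux L_T `PowDvdShaCardAtTwoRT` (stmt-BirchSwinnertonDyer-23242), LINE 18/19 stub 3a⁗, step (b):
# ONE RUNG OF THE SUPPLY from the swap oracle — McCallum's Prop. 5.2 minus its arithmetic

Seat `bsd-line-gk2-p2` g15, `--supports 23242 --as helper`; sequel of `…RTPrimeSwapping` (the loop) and `…RTPrimeSwappingRank`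
(the rank of `⟨s⟩`). Mathlib-only algebra; THEOREMS ONLY. BSD is not proved by any of this.

McCallum's Prop. 5.2 at depth `r`: «for every subgroup `C` of rank `≤ r` there is `n ∈ S_r(M)` with `c_M(n)` of order
`p^{M−M_r}` and `⟨c_M(n)⟩ ∩ C = 0`». The ladder (`…RTSelmerLadder`, hypothesis `hsupply`) consumes it with `C = ⟨s⟩`, `#s ≤` budget.
This file assembles, for ONE depth, that `hsupply`-shaped conclusion from:
* the SWAP ORACLE of `exists_good_separating_of_swapOracle` for every `C = ⟨s⟩`, `s ⊆ R`, `#s ≤ r` (the arithmetic: Čebotarev with a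
  prescribed non-vanishing, auxiliary class, reciprocity, Prop. 4.4 — inputs I3–I7 of `Lines/plus-descent-step-b-prop52.md`);
* an admissible START for every such `C` (the definition of `M_r`: a product of `r` Kolyvagin primes realising the minimal index);
* the LADDER CLASS `cls S ∈ R` attached to an admissible all-good `S` (`= p^{M−M_{r−1}} c_M(n_S)`), with `p^a ∣ ord (cls S)`
  (`a = M_{r−1} − M_r`) and `cls S ∈ A l` for `l ∈ S` (Prop. 4.4, strong form, from `p^{M_{r−1}} ∣ P_{n/l}`; Lemma 4.3 puts it in `R`).
Output (`exists_avoiding_of_swapOracle`): for every `s ⊆ R` with `#s ≤ r` there is `z ∈ R` with `p^a ∣ ord z` and `⟨z⟩ ∩ ⟨s⟩ = 0`.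

References: [McCallumLMS1991] §5 Prop. 5.2 (statement p. 308; proof pp. 308–310).
-/

-- `Summit.<P>.<Sub>` repeats `BirchSwinnertonDyer` by the tree's layout convention (D-0017)
set_option linter.dupNamespace false

namespace Summit.BirchSwinnertonDyer.BirchSwinnertonDyer.Theorems.GenusExact.PlusDescent

open AddSubgroup Finset

section Supply

variable {V : Type*} [AddCommGroup V]

/-- **One rung of McCallum's supply from the swap oracle** (Prop. 5.2 at one depth, with its arithmetic as hypotheses). `V` is
`p^M`-torsion; `R ≤ V` a finite subgroup (the relaxed Selmer group) in which the avoided sets live; `A l` the strict local conditions,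
of index `∣ p` on `⟨s⟩[p]` at good primes; `Inv` the admissibility invariant on `r`-sets of primes; for every `s ⊆ R` with `#s ≤ r`:
an admissible start and the swap oracle relative to `C = ⟨s⟩`; `cls S ∈ R` the ladder class of an admissible all-good `S`, with
`p^a ∣ ord (cls S)` and `cls S ∈ A l` for `l ∈ S`. Then every `s ⊆ R` with `#s ≤ r` is avoided by some `z ∈ R` with `p^a ∣ ord z`.
[cite: McCallumLMS1991, §5 Prop. 5.2] -/
theorem exists_avoiding_of_swapOracle {p : ℕ} (hp : p.Prime) {M : ℕ} (hV : ∀ v : V, p ^ M • v = 0)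
    (R : AddSubgroup V) [Finite R] (A : ℕ → AddSubgroup V) (good : ℕ → Prop) (r : ℕ) (Inv : Finset ℕ → Prop)
    (hcardS : ∀ S, Inv S → S.card = r)
    (hK : ∀ l, good l → ∀ s : Finset V, (↑s : Set V) ⊆ R →
      (A l).relIndex (AddSubgroup.closure (↑s : Set V) ⊓ AddSubgroup.torsionBy V (p : ℤ)) ∣ p)
    (start : ∀ s : Finset V, (↑s : Set V) ⊆ R → s.card ≤ r → ∃ S₀, Inv S₀)
    (oracle : ∀ s : Finset V, (↑s : Set V) ⊆ R → s.card ≤ r → ∀ S, Inv S → ∀ l₀ ∈ S,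
      ∀ c ∈ AddSubgroup.closure (↑s : Set V) ⊓ AddSubgroup.torsionBy V (p : ℤ),
      ∃ l', l' ∉ S ∧ good l' ∧ Inv (insert l' (S.erase l₀)) ∧ (c ≠ 0 → c ∉ A l'))
    (cls : Finset ℕ → V) {a : ℕ}
    (hcls : ∀ S, Inv S → (∀ l ∈ S, good l) → cls S ∈ R ∧ p ^ a ∣ addOrderOf (cls S) ∧ ∀ l ∈ S, cls S ∈ A l)
    (s : Finset V) (hs : (↑s : Set V) ⊆ R) (hsr : s.card ≤ r) :
    ∃ z ∈ R, p ^ a ∣ addOrderOf z ∧ Disjoint (AddSubgroup.zmultiples z) (AddSubgroup.closure (↑s : Set V)) := by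
  classical
  set C : AddSubgroup V := AddSubgroup.closure (↑s : Set V) with hC
  have hCR : C ≤ R := (AddSubgroup.closure_le R).mpr hs
  haveI : Finite C := Finite.of_injective _ (AddSubgroup.inclusion_injective hCR)
  -- the rank of `C`: `#C[p] = p^d`, `d ≤ #s ≤ r`
  obtain ⟨d, hd, hcard⟩ := exists_natCard_closure_inf_torsionBy_eq_pow (V := V) hp R s hs
  obtain ⟨S₀, hS₀⟩ := start s hs hsr
  obtain ⟨S, hS, hgood, hsep⟩ := exists_good_separating_of_swapOracle hp hV C hcard (hd.trans hsr) A good Inv hcardS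
    (fun l hl ↦ hK l hl s hs) S₀ hS₀ (oracle s hs hsr)
  obtain ⟨hR, hord, hA⟩ := hcls S hS hgood
  exact ⟨cls S, hR, hord, disjoint_zmultiples_of_forall_mem C A S hsep hA⟩

end Supply

end Summit.BirchSwinnertonDyer.BirchSwinnertonDyer.Theorems.GenusExact.PlusDescent
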